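import Literature.NumberTheory.ComplexMultiplication.HeckeCharactersOfReflexNormSectionLatticeClause
import Literature.NumberTheory.ComplexMultiplication.HeckeCharactersOfReflexNormSectionConverse
import HarnessLib

/-!
# Theorem 19.8's lattice clause from its local readings: `α(𝔬_v^×) ⊆ 𝔬_K^×` and `(α(⟨ϖ_v⟩)) = g(𝔭_v)` at every place
# give back `α(x)f(x)⁻¹𝔞 = 𝔞` for every idèle `x` (Shimura 1998, Thm. 19.8, (19.10b); Neukirch VII §6 (6.12)–(6.13))

Family `hodge`, lane `lit-hodgefound` (Layer A3, row A3-G30 of the A3 skeleton, FILE 2), topic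
`Literature/NumberTheory/ComplexMultiplication`; namespace `Literature.NumberTheory.ComplexMultiplication`.  Sequel of FILE 1
`…HeckeCharactersOfReflexNormSectionLatticeClause` (and of row A3-G29 FILE 3 `…Converse`, for `finitePart_infiniteIdeles` only) (the clause «`α(x)f(x)⁻¹𝔞 = 𝔞`» ⟺ «`(α(x)) = il(f(x))`» and its two local READINGS:
`α(⟨u⟩_v) ∈ 𝔬_K^×` for `u ∈ 𝔬_v^×`, `(α(⟨ϖ_v⟩)) = g(𝔭_v)`), which is the direction Casselman's hypotheses need.  THIS FILE proves the
CONVERSE — the two local readings at every finite place `v` of `k` imply the clause at every `x ∈ k_𝐀^×` — so that Theorem 19.8's lattice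
clause is EQUIVALENT to the pair (hypothesis 4, hypothesis 5) of `shimura1998_thm21_4_casselman` read for `α`
(`forall_spanSingleton_apply_eq_iff_local`).  Theorems only; no definition, no named fact (D-0026, net debt 0).

THE PRINT.  G. Shimura, *Abelian Varieties with Complex Multiplication and Modular Functions* (1998) [Shimura1998], Thm. 19.8 p. 134
[p0174 L17] «`α(x)f(x)⁻¹𝔞 = 𝔞` […] for every `x ∈ k_𝐀^×`»; Prop. 19.10 (19.10b) p. 136 [p0177 L14] «If `x ∈ k_𝐡^×`, then […] `χ(x)𝔞 = f(x)𝔞`»;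
proof of Thm. 19.11 p. 137 [p0178 L13–L20] («`β = α(π_𝔭)`», «`γ = α(y)` with `y ∈ 𝔬_𝔭^×`»).  J. Neukirch, *Algebraic Number Theory*
(1999) [NeukirchANT1999], Ch. VII §6: (6.11) `I_f^𝔪 ⊆ ker χ` («a module of definition»), (6.12) «`K_𝔭^* = (π) × U_𝔭`», and the proof
of Prop. (6.13) (an idèle with trivial archimedean part is `∏_{𝔭 ∈ S} ⟨α_𝔭⟩_𝔭` times an element of `I_f^𝔪`) — the decomposition used
here, exactly as in the GalRep trunk's `HeckeCharacter.IsModulus.coe_apply_eq_prod_localUnits_of_fst_eq_one`.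

WHAT IS PROVED.  §1 a small generic fact; §2 the clause at `x` is membership in the equaliser subgroup of `x ↦ (α(x))` and
`x ↦ il(f(x)_𝐡)` (`spanSingleton_apply_eq_iff_mem_eqLocus`), and at ONE place the readings at `𝔬_v^×` and `ϖ_v` give it on all of
`⟨k_v^×⟩_v` (`spanSingleton_apply_localUnits_eq`); §3 it holds on `k_𝐚^×` (`spanSingleton_apply_infiniteIdeles_eq`) and on the unit
idèles killed by `α` (`spanSingleton_apply_eq_of_mem_unitIdeles`); §4 **`spanSingleton_apply_eq_of_local`** (local readings at every `v`
⇒ the clause at every `x`) and the equivalence **`forall_spanSingleton_apply_eq_iff_local`**; §5 the number-theoretic clause shapes (3),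
(5a), (5c) of the FACT `shimuraTaniyama_heckeCharacters` for the family `(χ_τ)_τ` of `α`, at EVERY finite place
(`exists_forall_heckeCharacter_localUnits_eq`, `exists_forall_valueAtUniformizer_heckeCharacter_eq`; nothing of the FACT is restated —
its clauses (4), (5b) are geometric).

NOT HERE: anything geometric (Thm. 19.8's existence of `α`, Thm. 19.11); general **Z**-lattices with non-maximal order.

## References
* [Shimura1998] G. Shimura, *Abelian Varieties with Complex Multiplication and Modular Functions*, Princeton 1998, §18.3, §19.7,
  Thm. 19.8, Prop. 19.10 (19.10b), Thm. 19.11 (proof), §13.1 Thm. 1 (ii).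
* [NeukirchANT1999] J. Neukirch, *Algebraic Number Theory*, Springer 1999, Ch. II §3, Ch. VII §6 (6.11)–(6.13).
* [CasselsFrohlichANT1967] J. W. S. Cassels, A. Fröhlich (eds.), *Algebraic Number Theory*, Ch. II §16–§17.

## Provenance
Lane `lit-hodgefound` (Hodge path, Track 2, Layer A3), skeleton seat `lit-hodgefound-skel-3` (generation 20), row A3-G30 FILE 2 (lane INBOX
claim 2026-08-23T00:39:48Z, announced as OUTLOOK there and in the SUBMITTED line 2026-08-23T01:00:12Z).
-/

set_option autoImplicit false

noncomputable section

open scoped NumberField nonZeroDivisors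
open NumberField IsDedekindDomain WithZero

namespace Literature.NumberTheory.ComplexMultiplication

open Literature.AlgebraicGeometry.Motives (CMType)
open Literature.NumberTheory.GaloisRepresentations
open Literature.NumberTheory.NumberFields
open Literature.NumberTheory.Automorphic.FiniteAdeleRing (toFractionalIdeal unitOrd toFractionalIdeal_ne_zero
  unitOrd_eq_zero_iff)
/-! ## §1 A small fact: local units of valuation one -/

section Local

variable {K : Type} [Field K] [NumberField K] {Φ : CMType K} {k : IntermediateField ℚ ℂ} [NumberField k]

/-- An element of `k_v^×` of valuation `1` comes from `𝔬_v^×` (`𝔬_v^× = {|u|_v = 1}`).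
[cite: CasselsFrohlichANT1967, Ch. II §16 (the unit groups U_v)] [cite: NeukirchANT1999, Ch. II §3] -/
theorem exists_unitsMap_eq_of_valued_eq_one (v : HeightOneSpectrum (𝓞 k)) {u : (v.adicCompletion k)ˣ}
    (hu : Valued.v (u : v.adicCompletion k) = 1) :
    ∃ u' : (v.adicCompletionIntegers k)ˣ, Units.map ((v.adicCompletionIntegers k).subtype : _ →* _) u' = u := by
  have hmem : (u : v.adicCompletion k) ∈ v.adicCompletionIntegers k := by
    rw [HeightOneSpectrum.mem_adicCompletionIntegers, hu]
  have hunit : IsUnit (⟨(u : v.adicCompletion k), hmem⟩ : v.adicCompletionIntegers k) :=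
    (Valuation.Integers.isUnit_iff_valuation_eq_one (Valuation.valuationSubring.integers _)).2 hu
  exact ⟨hunit.unit, Units.ext rfl⟩

/-! ## §2 The clause as membership in an equaliser subgroup; one place from units and the uniformiser -/

namespace ReflexNormIdeleCharacter

variable (α : ReflexNormIdeleCharacter K Φ k)

/-- **The lattice clause at `x` is membership of `x` in an equaliser subgroup**: both sides of «`(α(x)) = il(f(x))`» are
values at `x` of homomorphisms `k_𝐀^× → I_K` into the ideal GROUP of `K` — `x ↦ (α(x))` (Mathlib `toPrincipalIdeal ∘ α`) and
`x ↦ il(f(x)_𝐡)` (A3-G26 `IdeleIdeal.toIdealUnits ∘ finitePart ∘ f`) — so the set of `x` satisfying the clause is the subgroup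
`MonoidHom.eqLocus` of the two. [cite: Shimura1998, Thm. 19.8 («α(x)f(x)⁻¹𝔞 = 𝔞 … for every x ∈ k_𝐀^×»)] [cite: CasselsFrohlichANT1967, Ch. II §17 (the homomorphism J_k → I_k)] -/
theorem spanSingleton_apply_eq_iff_mem_eqLocus (x : ideleGroup k) :
    FractionalIdeal.spanSingleton (𝓞 K)⁰ ((α x : Kˣ) : K) =
        toFractionalIdeal (𝓞 K) K (IdeleAction.finitePart K (reflexNormIdele K Φ k x)) ↔
      x ∈ ((toPrincipalIdeal (𝓞 K) K).comp α.toMonoidHom).eqLocus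
        ((IdeleIdeal.toIdealUnits (𝓞 K) K).comp ((IdeleAction.finitePart K).comp
          (reflexNormIdele K Φ k).toMonoidHom)) := by
  change _ ↔ toPrincipalIdeal (𝓞 K) K (α x) =
    IdeleIdeal.toIdealUnits (𝓞 K) K (IdeleAction.finitePart K (reflexNormIdele K Φ k x))
  rw [← Units.val_inj, coe_toPrincipalIdeal, IdeleIdeal.coe_toIdealUnits, toMonoidHom_apply]

/-- **AT ONE PLACE, THE TWO LOCAL READINGS GIVE THE CLAUSE ON ALL OF `k_v^×`**: if the clause holds at the idèles `⟨u⟩_v` of the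
local units `u ∈ 𝔬_v^×` and at `⟨ϖ_v⟩`, it holds at `⟨z⟩_v` for every `z ∈ k_v^×` — `k_v^× = ϖ_v^ℤ · 𝔬_v^×`, `z = (zϖ_v^a)·ϖ_v^{-a}` with
`|z|_v = q_v^{a}`… i.e. `zϖ_v^a ∈ 𝔬_v^×`, and the clause is multiplicative in `x` (§2). [cite: Shimura1998, Thm. 19.8 and proof of Thm. 19.11 p. 137 («β = α(π_𝔭)», «γ = α(y) with y ∈ 𝔬_𝔭^×»)]
[cite: NeukirchANT1999, Ch. VII §6 (6.12) («K_𝔭^* = (π) × U_𝔭»)] -/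
theorem spanSingleton_apply_localUnits_eq (v : HeightOneSpectrum (𝓞 k))
    (hU : ∀ u : (v.adicCompletionIntegers k)ˣ, FractionalIdeal.spanSingleton (𝓞 K)⁰
        ((α (localUnits v (Units.map ((v.adicCompletionIntegers k).subtype : _ →* _) u)) : Kˣ) : K) =
      toFractionalIdeal (𝓞 K) K (IdeleAction.finitePart K
        (reflexNormIdele K Φ k (localUnits v (Units.map ((v.adicCompletionIntegers k).subtype : _ →* _) u)))))
    (hP : FractionalIdeal.spanSingleton (𝓞 K)⁰
        ((α (localUnits v (HeckeCharacter.uniformizer k v)) : Kˣ) : K) =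
      toFractionalIdeal (𝓞 K) K (IdeleAction.finitePart K
        (reflexNormIdele K Φ k (localUnits v (HeckeCharacter.uniformizer k v)))))
    (z : (v.adicCompletion k)ˣ) :
    FractionalIdeal.spanSingleton (𝓞 K)⁰ ((α (localUnits v z) : Kˣ) : K) =
      toFractionalIdeal (𝓞 K) K (IdeleAction.finitePart K (reflexNormIdele K Φ k (localUnits v z))) := by
  rw [spanSingleton_apply_eq_iff_mem_eqLocus]
  set π := HeckeCharacter.uniformizer k v with hπ
  set a : ℤ := WithZero.log (Valued.v (z : v.adicCompletion k)) with ha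
  have hz0 : Valued.v (z : v.adicCompletion k) ≠ 0 := (map_ne_zero _).2 z.ne_zero
  have hza : Valued.v (z : v.adicCompletion k) = WithZero.exp a := (WithZero.exp_log hz0).symm
  have hu : Valued.v ((z * π ^ a : (v.adicCompletion k)ˣ) : v.adicCompletion k) = 1 := by
    rw [Units.val_mul, Units.val_zpow_eq_zpow_val, map_mul, map_zpow₀, hza,
      HeckeCharacter.valued_uniformizer, ← WithZero.exp_zsmul, smul_eq_mul, mul_neg, mul_one,
      ← WithZero.exp_add, add_neg_cancel, WithZero.exp_zero]
  obtain ⟨u', hu'⟩ := exists_unitsMap_eq_of_valued_eq_one v hu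
  have hz : z = (z * π ^ a) * π ^ (-a) := by
    rw [mul_assoc, ← zpow_add, add_neg_cancel, zpow_zero, mul_one]
  rw [hz, map_mul, map_zpow]
  refine Subgroup.mul_mem _ ?_ (Subgroup.zpow_mem _ ?_ _)
  · rw [← hu', ← spanSingleton_apply_eq_iff_mem_eqLocus]
    exact hU u'
  · rw [← spanSingleton_apply_eq_iff_mem_eqLocus]
    exact hP

/-! ## §3 The archimedean part and the unit idèles killed by `α` -/

/-- **The clause holds on `k_𝐚^×`**: for an infinite idèle `(y, 1)`, `α((y,1)) = 1` (A3-G29 `apply_infiniteIdeles_eq_one`, `k` totally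
complex) and `f((y,1))_𝐡 = g_f(1) = 1` (row A3-G29 FILE 3 `finitePart_infiniteIdeles`), so both sides are `(1)`. [cite: Shimura1998, Prop. 19.10 (proof: «If x ∈ k_𝐚^× … α(x) = 1») and (19.7a)] -/
theorem spanSingleton_apply_infiniteIdeles_eq [IsTotallyComplex k] (hk : traceField Φ ≤ k)
    (y : (InfiniteAdeleRing k)ˣ) :
    FractionalIdeal.spanSingleton (𝓞 K)⁰ ((α (infiniteIdeles k y) : Kˣ) : K) =
      toFractionalIdeal (𝓞 K) K (IdeleAction.finitePart K (reflexNormIdele K Φ k (infiniteIdeles k y))) := by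
  rw [toMonoidHom_apply, α.apply_infiniteIdeles_eq_one hk, Units.val_one, FractionalIdeal.spanSingleton_one,
    finitePart_reflexNormIdele, finitePart_infiniteIdeles, map_one, IdeleAction.toFractionalIdeal_one]

/-- **The clause holds on `Ker(α) ∩ (unit idèles)`**: if every finite component of `y` is a local unit and `α(y) = 1`, then
`(α(y)) = (1) = g(il(y_𝐡)) = il(f(y))` (`il(y_𝐡) = (1)`; A3-G26 `il(f(y)) = g(il(y_𝐡))` in an admissible presentation, which exists by
FILE 1 `exists_galoisPresentation`). [cite: Shimura1998, Thm. 19.8 («Ker(α) is open»), §18.5 («𝔶 = g(𝔵)»)] [cite: CasselsFrohlichANT1967, Ch. II §17 (the unit idèles are the kernel of J_k → I_k)] -/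
theorem spanSingleton_apply_eq_of_mem_unitIdeles (hk : traceField Φ ≤ k) {y : ideleGroup k}
    (hy : y ∈ unitIdeles k) (hαy : α y = 1) :
    FractionalIdeal.spanSingleton (𝓞 K)⁰ ((α y : Kˣ) : K) =
      toFractionalIdeal (𝓞 K) K (IdeleAction.finitePart K (reflexNormIdele K Φ k y)) := by
  obtain ⟨L, _, _, _, ι, σL, hσ, ⟨j⟩⟩ := exists_galoisPresentation K k
  rw [toMonoidHom_apply, hαy, Units.val_one, FractionalIdeal.spanSingleton_one,
    toFractionalIdeal_finitePart_reflexNormIdele K Φ k hk ι j σL hσ,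
    IdeleAction.toFractionalIdeal_eq_one_of_unitOrd ((IdeleAction.forall_unitOrd_finitePart_eq_zero_iff k y).2 hy),
    map_one]

/-! ## §4 The lattice clause from its local readings -/

/-- **THEOREM 19.8's LATTICE CLAUSE FROM ITS LOCAL READINGS.**  Let `K` be a number field with CM type `Φ`, `k ⊂ ℂ` a totally complex
number field containing `K* = E*` (`traceField Φ ≤ k`; total complexity is automatic for `K` CM, A3-G29 `isTotallyComplex_of_traceField_le`),
and `α : k_𝐀^× → K^×` with open kernel extending `N_{k,Φ}` (A3-G29's INPUT `ReflexNormIdeleCharacter`).  If «`(α(x)) = il(f(x))`» holds at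
the idèles `⟨u⟩_v` of all local units `u ∈ 𝔬_v^×` and at `⟨ϖ_v⟩` for every finite place `v` — i.e. `α(𝔬_v^×) ⊆ 𝔬_K^×` and
`(α(⟨ϖ_v⟩)) = g(𝔭_v)` (FILE 1 §3–§4) — then it holds at EVERY `x ∈ k_𝐀^×`.  PROOF (Neukirch's decomposition of an idèle, as in the
trunk's `IsModulus.coe_apply_eq_prod_localUnits_of_fst_eq_one`): `x = (x_𝐚, 1)·y` with `y_𝐚 = 1` (§3 handles `(x_𝐚, 1)`); take a module
of definition `(T, e)` of the Hecke character `χ_τ` of `α` (trunk `exists_isModulus`) and a finite `S ⊇ T` outside which `y` is a unit;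
with `G = ∏_{w ∈ S} ⟨y_w⟩_w`, the idèle `yG⁻¹` is a unit idèle, `≡ 1` at `T`, so `χ_τ(yG⁻¹) = 1`, i.e. `α(yG⁻¹) = 1` (`χ_τ = τ ∘ α` on
`k_𝐡^×`), and §3 applies to it; `G` satisfies the clause factor by factor (§2); the clause is multiplicative.
[cite: Shimura1998, Thm. 19.8, Prop. 19.10 (19.10b) («χ(x)𝔞 = f(x)𝔞»), proof of Thm. 19.11 p. 137] [cite: NeukirchANT1999, Ch. VII §6 (6.11)–(6.13) (proof of (6.13): decomposition of an idèle modulo I_f^𝔪)] -/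
theorem spanSingleton_apply_eq_of_local [IsTotallyComplex k] (hk : traceField Φ ≤ k)
    (hU : ∀ (v : HeightOneSpectrum (𝓞 k)) (u : (v.adicCompletionIntegers k)ˣ), FractionalIdeal.spanSingleton (𝓞 K)⁰
        ((α (localUnits v (Units.map ((v.adicCompletionIntegers k).subtype : _ →* _) u)) : Kˣ) : K) =
      toFractionalIdeal (𝓞 K) K (IdeleAction.finitePart K
        (reflexNormIdele K Φ k (localUnits v (Units.map ((v.adicCompletionIntegers k).subtype : _ →* _) u)))))
    (hP : ∀ v : HeightOneSpectrum (𝓞 k), FractionalIdeal.spanSingleton (𝓞 K)⁰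
        ((α (localUnits v (HeckeCharacter.uniformizer k v)) : Kˣ) : K) =
      toFractionalIdeal (𝓞 K) K (IdeleAction.finitePart K
        (reflexNormIdele K Φ k (localUnits v (HeckeCharacter.uniformizer k v)))))
    (x : ideleGroup k) :
    FractionalIdeal.spanSingleton (𝓞 K)⁰ ((α x : Kˣ) : K) =
      toFractionalIdeal (𝓞 K) K (IdeleAction.finitePart K (reflexNormIdele K Φ k x)) := by
  classical
  obtain ⟨τ⟩ : Nonempty (K →+* ℂ) := inferInstance
  -- split off the archimedean part: `x = (x_𝐚, 1) · y` with `y_𝐚 = 1`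
  set y : ideleGroup k := (infiniteIdeles k (HeckeCharacter.infPart k x))⁻¹ * x with hy
  have hy1 : (y : AdeleRing (𝓞 k) k).1 = 1 := (HeckeCharacter.infiniteIdeles_infPart_inv_mul x).1
  have hx : x = infiniteIdeles k (HeckeCharacter.infPart k x) * y := by rw [hy, mul_inv_cancel_left]
  rw [hx, spanSingleton_apply_eq_iff_mem_eqLocus]
  refine Subgroup.mul_mem _ ((α.spanSingleton_apply_eq_iff_mem_eqLocus _).1
    (α.spanSingleton_apply_infiniteIdeles_eq hk _)) ?_
  -- a module of definition `(T, e)` of `χ_τ`, and the finite set `S ⊇ T` outside which `y` is a unit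
  obtain ⟨T, e, hmod⟩ := (α.heckeCharacter τ).exists_isModulus
  have hfin := ideleGroup_valued_snd_eventually_eq_one y
  rw [Filter.eventually_cofinite] at hfin
  set S : Finset (HeightOneSpectrum (𝓞 k)) := T ∪ hfin.toFinset with hS
  have hSout : ∀ w ∉ S, Valued.v ((y : AdeleRing (𝓞 k) k).2 w) = 1 := by
    intro w hw
    by_contra hne
    exact hw (Finset.mem_union_right _ (hfin.mem_toFinset.2 hne))
  -- Neukirch's decomposition `y = (y G⁻¹) · G`, `G = ∏_{w ∈ S} ⟨y_w⟩_w`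
  let u : ∀ q : HeightOneSpectrum (𝓞 k), (q.adicCompletion k)ˣ := fun q =>
    Units.mk0 ((y : AdeleRing (𝓞 k) k).2 q) (ideleGroup_snd_ne_zero y q)
  set G : ideleGroup k := ∏ q ∈ S, localUnits q (u q) with hG
  have hG1 : ((y * G⁻¹ : ideleGroup k) : AdeleRing (𝓞 k) k).1 = 1 := by
    rw [ideleGroup_val_fst_mul, hy1, one_mul]
    have h := ideleGroup_val_inv_fst_mul G
    rwa [hG, fst_prod_localUnits, mul_one] at h
  have hGu : ∀ w, Valued.v (((y * G⁻¹ : ideleGroup k) : AdeleRing (𝓞 k) k).2 w) = 1 := fun w => by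
    rw [ideleGroup_val_snd_mul, ideleGroup_val_inv_snd, hG, snd_prod_localUnits]
    split_ifs with hw
    · rw [Units.val_mk0, mul_inv_cancel₀ (ideleGroup_snd_ne_zero y w), map_one]
    · rw [inv_one, mul_one]
      exact hSout w hw
  have hz : α.heckeCharacter τ (y * G⁻¹) = 1 := by
    refine hmod _ hG1 hGu (fun w hw => ?_)
    rw [ideleGroup_val_snd_mul, ideleGroup_val_inv_snd, hG, snd_prod_localUnits, if_pos (Finset.mem_union_left _ hw),
      Units.val_mk0, mul_inv_cancel₀ (ideleGroup_snd_ne_zero y w), sub_self, map_zero]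
    exact zero_le
  -- hence `α (y G⁻¹) = 1` (`χ_τ = τ ∘ α` on `k_𝐡^×`) and `y G⁻¹` is a unit idèle: it satisfies the clause
  have hαz : α (y * G⁻¹) = 1 := by
    have h := α.coe_heckeCharacter_of_fst_eq_one τ hG1
    rw [hz, Units.val_one, ← τ.map_one, τ.injective.eq_iff, ← Units.val_one, Units.val_inj] at h
    exact h.symm
  have hmemz := (α.spanSingleton_apply_eq_iff_mem_eqLocus _).1
    (α.spanSingleton_apply_eq_of_mem_unitIdeles hk (mem_unitIdeles_iff.2 hGu) hαz)
  -- and `G` satisfies it factor by factor (§ one place)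
  have hmemG : G ∈ ((toPrincipalIdeal (𝓞 K) K).comp α.toMonoidHom).eqLocus
      ((IdeleIdeal.toIdealUnits (𝓞 K) K).comp ((IdeleAction.finitePart K).comp
        (reflexNormIdele K Φ k).toMonoidHom)) := by
    rw [hG]
    exact Subgroup.prod_mem _ fun w _ => (α.spanSingleton_apply_eq_iff_mem_eqLocus _).1
      (α.spanSingleton_apply_localUnits_eq w (hU w) (hP w) (u w))
  have hyG : y = (y * G⁻¹) * G := by rw [inv_mul_cancel_right]
  rw [hyG]
  exact Subgroup.mul_mem _ hmemz hmemG

/-- **THEOREM 19.8's LATTICE CLAUSE ⟺ ITS TWO LOCAL READINGS AT EVERY PLACE** («`α(x)f(x)⁻¹𝔞 = 𝔞` for every `x ∈ k_𝐀^×`», for a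
lattice with maximal order, FILE 1 §2) iff (`α(⟨u⟩_v)` satisfies it for all `u ∈ 𝔬_v^×`, all `v`) and (`α(⟨ϖ_v⟩)` satisfies it for all `v`)
— with FILE 1 §3–§4: iff `α(𝔬_v^×) ⊆ 𝔬_K^×` and `(α(⟨ϖ_v⟩)) = g(𝔭_v)` for every finite place `v` of `k`.
[cite: Shimura1998, Thm. 19.8, Prop. 19.10 (19.10b), proof of Thm. 19.11 p. 137; §13.1 Thm. 1 (ii)] [cite: NeukirchANT1999, Ch. VII §6 (6.12)–(6.13)] -/
theorem forall_spanSingleton_apply_eq_iff_local [IsTotallyComplex k] (hk : traceField Φ ≤ k) :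
    (∀ x : ideleGroup k, FractionalIdeal.spanSingleton (𝓞 K)⁰ ((α x : Kˣ) : K) =
      toFractionalIdeal (𝓞 K) K (IdeleAction.finitePart K (reflexNormIdele K Φ k x))) ↔
    (∀ (v : HeightOneSpectrum (𝓞 k)) (u : (v.adicCompletionIntegers k)ˣ), FractionalIdeal.spanSingleton (𝓞 K)⁰
        ((α (localUnits v (Units.map ((v.adicCompletionIntegers k).subtype : _ →* _) u)) : Kˣ) : K) =
      toFractionalIdeal (𝓞 K) K (IdeleAction.finitePart K
        (reflexNormIdele K Φ k (localUnits v (Units.map ((v.adicCompletionIntegers k).subtype : _ →* _) u))))) ∧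
    (∀ v : HeightOneSpectrum (𝓞 k), FractionalIdeal.spanSingleton (𝓞 K)⁰
        ((α (localUnits v (HeckeCharacter.uniformizer k v)) : Kˣ) : K) =
      toFractionalIdeal (𝓞 K) K (IdeleAction.finitePart K
        (reflexNormIdele K Φ k (localUnits v (HeckeCharacter.uniformizer k v))))) :=
  ⟨fun h => ⟨fun _ _ => h _, fun _ => h _⟩, fun h x => α.spanSingleton_apply_eq_of_local hk h.1 h.2 x⟩


/-! ## §5 The number-theoretic clause shapes of `shimuraTaniyama_heckeCharacters` for the family `(χ_τ)_τ` of `α` -/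

/-- **Clause (3) of `shimuraTaniyama_heckeCharacters` for the family of `α`** («If `x ∈ k_𝐡^×`, then `χ(x) ∈ K^×`», (19.10c)): on a
local idèle `⟨u⟩_v` the whole family `(χ_τ)_τ` is the family of complex embeddings of ONE element `b = α(⟨u⟩_v)` of `K` (A3-G29
`coe_heckeCharacter_localUnits`; no lattice clause needed). [cite: Shimura1998, Prop. 19.10 (19.10b), (19.10c)] [cite: SerreTate1968, §7 Thm. 11 (ii)] -/
theorem exists_forall_heckeCharacter_localUnits_eq (v : HeightOneSpectrum (𝓞 k)) (u : (v.adicCompletion k)ˣ) :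
    ∃ b : K, ∀ τ : K →+* ℂ, ((α.heckeCharacter τ (localUnits v u) : ℂˣ) : ℂ) = τ b :=
  ⟨(α (localUnits v u) : Kˣ), fun τ => α.coe_heckeCharacter_localUnits τ v u⟩

/-- **Clauses (5a) and (5c) of `shimuraTaniyama_heckeCharacters` for the family of `α`, AT EVERY FINITE PLACE** (not only at the good
ones), from the lattice clause at `⟨ϖ_v⟩`: there is ONE `π = α(⟨ϖ_v⟩) ∈ 𝔬_K` with «`χ_τ(π_𝔭) = β_τ`» — `χ_τ(ϖ_v) = τ(π)` for EVERY `τ` —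
and «`g(N_{k/K*}(𝔓)) = π₀𝔬`» — `IsReflexTypeNorm (valuedIn ι_L Φ) j σ_L 𝔭_v (π)` in every normal presentation (FILE 1 §4).  Clause (5b)
(the action of Frobenius on `T_ℓ A`) is geometric and is not here.
[cite: Shimura1998, proof of Thm. 19.11 p. 137 («Put β = α(π_𝔭) … χ_τ(π_𝔭) = β_τ»); §13.1 Thm. 1 (ii)] [cite: SerreTate1968, §7 Thm. 10 (c)] -/
theorem exists_forall_valueAtUniformizer_heckeCharacter_eq (hk : traceField Φ ≤ k) (v : HeightOneSpectrum (𝓞 k))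
    (hx : FractionalIdeal.spanSingleton (𝓞 K)⁰
        ((α (localUnits v (HeckeCharacter.uniformizer k v)) : Kˣ) : K) =
      toFractionalIdeal (𝓞 K) K (IdeleAction.finitePart K
        (reflexNormIdele K Φ k (localUnits v (HeckeCharacter.uniformizer k v))))) :
    ∃ π : 𝓞 K, (∀ τ : K →+* ℂ, (α.heckeCharacter τ).valueAtUniformizer v = τ (π : K)) ∧
      ∀ (L : Type) [Field L] [NumberField L] [Normal ℚ L] (ιL : L →+* ℂ) (j : K →+* L) (σL : k →+* L),
        ιL.comp σL = algebraMap k ℂ → IsReflexTypeNorm (valuedIn ιL Φ.1) j σL v.asIdeal (Ideal.span {π}) := by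
  obtain ⟨L, _, _, _, ι, σL, hσ, ⟨j⟩⟩ := exists_galoisPresentation K k
  obtain ⟨π, hπ, -⟩ := α.exists_eq_apply_uniformizer_span_eq hk ι j σL hσ v hx
  refine ⟨π, fun τ => ?_, fun L _ _ _ ιL j' σL' hσ' => α.isReflexTypeNorm_span_of_eq_apply_uniformizer hk ιL j' σL' hσ' v hx hπ⟩
  rw [HeckeCharacter.valueAtUniformizer, HeckeCharacter.localComponent_apply, α.coe_heckeCharacter_localUnits,
    toMonoidHom_apply, hπ]

end ReflexNormIdeleCharacter

end Local

end Literature.NumberTheory.ComplexMultiplication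

end
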